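import Summits.RiemannHypothesis.RiemannHypothesis.Theses.WeilParity
import Summits.RiemannHypothesis.RiemannHypothesis.Theorems.WeilParityEvenWinsBeyondArchSplit
import Summits.RiemannHypothesis.RiemannHypothesis.Theorems.WeilParityEvenWinsArch
import Literature.NumberTheory.LFunctions.WeilFirstPrimePositivityC
import Literature.NumberTheory.LFunctions.WeilResolventVector
import HarnessLib

/-!
# Disproof of `EvenWinsBeyondArch` (stmt-RiemannHypothesis-15432) — standing adversary, cycle 1

Crux (route WeilParity, rank 3), in ground-energy language (`evenWinsBeyondArch_iff`, landed p148526):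
`EvenWinsBeyondArch ↔ ∀ a > (log 2)/2, ε_ev(a) ≤ ε_od(a)` — beyond the archimedean window the EVEN sector
bottom `ε_ev = weilEvenGroundEnergy` (Bombieri's `μ⁺(e^a)`) of Weil's windowed form never lies above the ODD
one `ε_od = weilOddGroundEnergy` (`μ⁻(e^a)`).

## Findings (numbers, not adjectives)

* NO KILL.  Verdict of cycle 1: the crux resists cheap refutation; a refutation is a window `a₀` with a STRICT odd win
  (an open condition, so an open interval of such windows — visible to an ORDER scan, `exists_interval_of_not_evenWinsBeyondArch`),
  it forces an EXACT parity tie between `(log 2)/2` and `a₀` (`exists_tie_of_not_evenWinsBeyondArch`, §1), and it is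
  RH-strength (`evenWinsBeyondArch_false_of_detection_of_not_RH`:
  under ¬RH the crux is false as soon as crux #2 `OffLineParityDetection` holds — the route's deciding theorem
  rearranged, now that `EvenWinsArch` is a theorem).
* ELABORATION: rc 0 (probe `W.lean`); statement junk-free (for `a > (log 2)/2 > 0` both spheres are nonempty,
  values bounded below; `δ`-matching form ⇔ `ε_ev ≤ ε_od`).
* KILL CRITERION (§1, `evenWinsBeyondArch_false_of_witness`): ONE window `a > (log 2)/2`, ONE odd normalised
  window test `o` and a number `m` with `Re Q(o) < m ≤ Re Q(e)` for every even normalised window test `e`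
  (i.e. a certified even-sector LOWER bound above one odd Rayleigh quotient).  Precision wall: for `a ≥ 0.75`
  both bottoms are `< 1e-14` (table below), so no such certificate is in reach; for `a ≤ 1.2` the sister scan
  and for `1.25 ≤ a ≤ 1.8` THIS scan find `ε_ev < ε_od` with a GROWING ratio (no window to certify against).
* LOAD-BEARING HYPOTHESES (§2, kernel-checked):
  - evenness of the matching test `e` carries ALL the content: without it the statement is trivially true
    (`evenWinsBeyondArchWithoutEven_trivial`, witness `e := o`);
  - oddness of the competitor `o` is NOT load-bearing (`evenWinsBeyondArchWithoutOdd_iff`: dropping it gives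
    an EQUIVALENT statement, `ε = min(ε_ev, ε_od)`);
  - the window threshold `(log 2)/2 < a` is NOT load-bearing GIVEN the tree (`evenWinsBeyondArchAllWindows_iff`:
    `a ≤ 0` is vacuous, `0 < a ≤ (log 2)/2` is the landed `evenWinsArch_proof`);
  - the normalisation of `e` is load-bearing only through odd-sector positivity: dropping it makes the crux
    TRUE under RH (`…WithoutNormE_of_riemannHypothesis`, witness `e := 0`, Yoshida) and RH-free on the
    one-prime window (`…WithoutNormE_onePrime`, landed `weilPositivityOn_log_three_half`);
  - the normalisation of `o` is load-bearing iff `0 < ε_ev(a)` at some `a > (log 2)/2`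
    (`…WithoutNormO_false_of_pos`); numerically `ε_ev(1/2) = 9.37e-7 > 0`, but the tree's certificates
    export `0 ≤` only — no kernel proof of strict positivity beyond `(log 2)/2` exists yet;
  - the window of `o` (`tsupport o ⊆ [-a,a]`) is numerically load-bearing (`ε_od(1.0) ≈ 1.5e-26 < ε_ev(a)`
    for every `a ≤ 0.9`), kernel proof blocked by the same missing strict-positivity input;
  - the `δ`-free (attained) version is sandwiched: Connes' strict clause ⇒ it ⇒ crux (`§2`), not separately attackable.
* NATURAL VARIANT REFUTED (§3, RH-free, kernel-checked): the parity-swapped crux `OddWinsBeyondArch`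
  (`ε_od ≤ ε_ev` beyond the archimedean window) is FALSE: the certified anchor `ε_ev < ε_od` at `(log 2)/2`
  (p148526) and the landed sector continuity (p146566) give a strict even win on an initial segment
  `((log 2)/2, (log 2)/2 + η)` (`exists_strict_order_beyond_arch`, `not_oddWinsBeyondArch`).
* LINE `split` (§4): joint sufficiency is kernel-checked (p148526); the two stubs are jointly EQUIVALENT to
  "no parity tie at any `a > (log 2)/2`" (`subs_iff_noTie_beyond_arch`) — the line proves the crux PLUS the
  exclusion of touching ties, nothing more; `stub_noParityCrossing` is sign-blind (irrefutable numerically: a tie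
  is an equality) and RH-strength (`stub_noParityCrossing_false_of_detection_of_not_RH`);
  `stub_onePrimeWindowSimpleEven` is numerically true with cell margins ≈ 10× (sister table; re-verified here at
  `a = 0.4, 0.5`: `e1 = 1.815e-4 / 9.37e-7`, `o1/e1 = 81.1 / 208`).
* NUMERICS — the lead's `disprover-wanted` ORDER scan beyond `a = 1.2` (route falsifier F2 / kill k2).  New RH-free
  geometric-side code (kit j024889 / j024890; `scan/` in the disprover folder; INDEPENDENT of the sister's: exact
  fixed-point big-integer arithmetic, all polynomial integrals by exact Gauss–Legendre rules, the archimedean term as the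
  Markovian form `−C_A‖g‖² + ½∫₀^∞ (e^{t/2}/sinh t)‖g − g(·−t)‖² dt`, `C_A = log 8π + γ + π/2`; validated against the
  sister table to all printed digits: `ε(0.1) = 0.45713, ε(0.3) = 7.572e-3, ε(0.4) = 1.8149e-4 (o1/e1 81.1, e2/e1 1693,
  ⟨u,1⟩ 0.765), ε(0.5) = 9.37e-7 (o1/e1 208)`).  RESULT for `a ∈ {1.25, 1.3, 1.35, 1.4, 1.5, 1.6, 1.7, 1.8}` (§5): EVEN WINS EVERYWHERE, `o1/e1 = (1.25 ± 0.15)·c²`,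
  `c = 2π e^{2a}`, growing 7.3e3 → 6.5e4; interlacing even<odd<even<odd at every window; no crossing 170 orders of magnitude
  below the precision wall; the sector bottoms follow the prolate defects `1 − λ₄(c)`, `1 − λ₆(c)` within a factor 4–6 (§6).

## Why it resists (for the provers)

* B1 (RH-strength): `¬RH ∧ OffLineParityDetection → ¬EvenWinsBeyondArch` (§1); no zero-blind lever can prove it,
  no unconditional refutation can come from large `a`.
* B2 (precision wall): a kill needs a certified even-sector lower bound above an odd trial value at ONE window; both
  bottoms decay like `exp(−4π e^{2a})`, `< 1e-14` from `a = 0.75` on.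
* B3 (structure): any counterexample forces an exact tie `ε_ev(a) = ε_od(a)` below it (§1) and an interval of strict odd
  wins around it; under RH both are contradicted by Connes' prolate picture (sector defects `1 − λ₄(c) ≪ 1 − λ₆(c)`, ratio `≍ c²`, `c = 2π e^{2a}`), which
  the data follow (`ln e1 ≈ −4π e^{2a} + 9a + 15.8`, exponent `n + 1/2 = 4.5` ↔ prolate index 4).

Everything below is `sorry`-free; §3 and the load-bearing lemmas are proposed under
`Summits/RiemannHypothesis/RiemannHypothesis/Theorems/EvenWinsBeyondArch/Negative/`.
-/

noncomputable section

set_option linter.dupNamespace false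

open Set MeasureTheory Filter
open scoped Real Topology ComplexConjugate

namespace Summit.RiemannHypothesis.RiemannHypothesis.Cruxes.EvenWinsBeyondArch.Disproof

open Literature.NumberTheory.LFunctions
open Summit.RiemannHypothesis.RiemannHypothesis.Theses.WeilParity
open Summit.RiemannHypothesis.RiemannHypothesis.Theorems
open Summit.RiemannHypothesis.RiemannHypothesis.Theorems.EvenWinsBeyondArch

/-! ## 1. The crux in ground-energy language; kill criteria; why a kill is a tie -/

/-- The crux is the order of the two sector bottoms beyond the archimedean window (landed, p148526). [folklore] -/
theorem evenWinsBeyondArch_iff :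
    EvenWinsBeyondArch ↔ ∀ a : ℝ, Real.log 2 / 2 < a → weilEvenGroundEnergy a ≤ weilOddGroundEnergy a :=
  evenWinsBeyondArch_iff_forall_le

/-- **Negation normal form**: the crux fails iff at SOME window beyond `(log 2)/2` the odd bottom is
strictly below the even bottom. [folklore] -/
theorem not_evenWinsBeyondArch_iff :
    ¬ EvenWinsBeyondArch ↔ ∃ a : ℝ, Real.log 2 / 2 < a ∧ weilOddGroundEnergy a < weilEvenGroundEnergy a := by
  rw [evenWinsBeyondArch_iff]
  push Not
  rfl

/-- **KILL CRITERION** (what a certified refutation must produce): one window `a > (log 2)/2`, ONE odd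
normalised window test `o`, and a number `m` with `Re Q(o) < m` that is a LOWER bound for the whole even
normalised sphere of the window. [folklore] -/
theorem evenWinsBeyondArch_false_of_witness {a m : ℝ} (ha : Real.log 2 / 2 < a) {o : ℝ → ℂ}
    (ho : IsWeilTest o) (hos : tsupport o ⊆ Icc (-a) a) (hodd : ∀ t, o (-t) = -o t)
    (hon : ∫ t, ‖o t‖ ^ 2 = (1 : ℝ)) (hlt : (weilQuadratic o).re < m)
    (hm : ∀ e : ℝ → ℂ, IsWeilTest e → tsupport e ⊆ Icc (-a) a → (∀ t, e (-t) = e t) →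
      ∫ t, ‖e t‖ ^ 2 = (1 : ℝ) → m ≤ (weilQuadratic e).re) :
    ¬ EvenWinsBeyondArch := by
  rw [not_evenWinsBeyondArch_iff]
  refine ⟨a, ha, ?_⟩
  have h1 : weilOddGroundEnergy a ≤ (weilQuadratic o).re := weilOddGroundEnergy_le ho hos hodd hon
  have h2 : m ≤ weilEvenGroundEnergy a :=
    le_weilEvenGroundEnergy_of_forall (log_two_half_pos.trans ha) fun e he hes hev hen ↦ hm e he hes hev hen
  linarith

/-- **Any counterexample forces an exact parity tie** beyond the archimedean window: the order is certified at
`(log 2)/2` and both sector bottoms are continuous (landed), so a failure of `≤` at `a₀` forces a zero of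
`ε_od − ε_ev` on `((log 2)/2, a₀)` (contrapositive of the landed `evenWinsBeyondArch_of_noCrossing_beyond_arch`).
[folklore] -/
theorem exists_tie_of_not_evenWinsBeyondArch (h : ¬ EvenWinsBeyondArch) :
    ∃ a : ℝ, Real.log 2 / 2 < a ∧ weilEvenGroundEnergy a = weilOddGroundEnergy a := by
  by_contra hne
  push Not at hne
  exact h (evenWinsBeyondArch_of_noCrossing_beyond_arch hne)

/-- **… but the counterexample window itself is robust**: a failure at `a₀` is a STRICT inequality between functions
continuous at `a₀` (landed), hence persists on an open interval around `a₀` — an ORDER scan over windows can see it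
(this is what the numerics of §5 test), while the forced tie sits elsewhere, between `(log 2)/2` and `a₀`. [folklore] -/
theorem exists_interval_of_not_evenWinsBeyondArch (h : ¬ EvenWinsBeyondArch) :
    ∃ a₀ : ℝ, Real.log 2 / 2 < a₀ ∧ ∃ η : ℝ, 0 < η ∧ ∀ a : ℝ, dist a a₀ < η →
      weilOddGroundEnergy a < weilEvenGroundEnergy a := by
  obtain ⟨a₀, ha₀, hlt⟩ := not_evenWinsBeyondArch_iff.1 h
  have h0 : 0 < a₀ := log_two_half_pos.trans ha₀
  have hev : ContinuousAt weilEvenGroundEnergy a₀ := stub_sectorContinuity_continuousAt_even h0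
  have hod : ContinuousAt weilOddGroundEnergy a₀ := stub_sectorContinuity_continuousAt_odd h0
  obtain ⟨η, hη, hI⟩ := Metric.eventually_nhds_iff.1 (Filter.Tendsto.eventually_lt hod hev hlt)
  exact ⟨a₀, ha₀, η, hη, fun a ha ↦ hI ha⟩

/-- **RH-strength, formally (barrier B1).** Under `¬RH` the crux is FALSE as soon as the route's detection crux
`OffLineParityDetection` holds: the route's deciding theorem `closes` rearranged, with `EvenWinsArch` now a
theorem (`evenWinsArch_proof`). So no RH-free proof of the crux exists unless crux #2 fails, and no
unconditional refutation exists unless RH fails. [folklore] -/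
theorem evenWinsBeyondArch_false_of_detection_of_not_RH (hdet : OffLineParityDetection)
    (hRH : ¬ _root_.Summit.RiemannHypothesis) : ¬ EvenWinsBeyondArch :=
  fun h ↦ hRH (closes WeilParity.evenWinsArch_proof h hdet)

/-! ## 2. Load-bearing hypotheses: the crux with one hypothesis deleted -/

/-- The crux with the EVENNESS of the matching test deleted. -/
def EvenWinsBeyondArchWithoutEven : Prop :=
  ∀ a : ℝ, Real.log 2 / 2 < a → ∀ o : ℝ → ℂ, IsWeilTest o → tsupport o ⊆ Icc (-a) a →
    (∀ t, o (-t) = -o t) → ∫ t, ‖o t‖ ^ 2 = (1 : ℝ) → ∀ δ : ℝ, 0 < δ → ∃ e : ℝ → ℂ, IsWeilTest e ∧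
      tsupport e ⊆ Icc (-a) a ∧ ∫ t, ‖e t‖ ^ 2 = (1 : ℝ) ∧ (weilQuadratic e).re ≤ (weilQuadratic o).re + δ

/-- **All the content sits in the evenness of `e`**: without it the crux is trivially true (take `e := o`).
[folklore] -/
theorem evenWinsBeyondArchWithoutEven_trivial : EvenWinsBeyondArchWithoutEven :=
  fun _ _ o ho hos _ hon δ hδ ↦ ⟨o, ho, hos, hon, by linarith⟩

/-- The crux with the ODDNESS of the competitor deleted (every normalised window test must be matched). -/
def EvenWinsBeyondArchWithoutOdd : Prop :=
  ∀ a : ℝ, Real.log 2 / 2 < a → ∀ o : ℝ → ℂ, IsWeilTest o → tsupport o ⊆ Icc (-a) a →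
    ∫ t, ‖o t‖ ^ 2 = (1 : ℝ) → ∀ δ : ℝ, 0 < δ → ∃ e : ℝ → ℂ, IsWeilTest e ∧
      tsupport e ⊆ Icc (-a) a ∧ (∀ t, e (-t) = e t) ∧ ∫ t, ‖e t‖ ^ 2 = (1 : ℝ) ∧
        (weilQuadratic e).re ≤ (weilQuadratic o).re + δ

/-- **Oddness of the competitor is NOT load-bearing**: deleting it gives an EQUIVALENT statement, because
`ε(a) = min(ε_ev(a), ε_od(a))` (`weilGroundEnergy_eq_min_even_odd`): if the even bottom is below the odd one
it is the global bottom, so EVERY normalised window test is matched by even ones.  (Information for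
provers: no proof can exploit the oddness of `o` beyond `Re Q(o) ≥ ε_od(a)`.) [folklore] -/
theorem evenWinsBeyondArchWithoutOdd_iff : EvenWinsBeyondArchWithoutOdd ↔ EvenWinsBeyondArch := by
  refine ⟨fun h a ha o ho hos _ hon δ hδ ↦ h a ha o ho hos hon δ hδ, fun h a ha o ho hos hon δ hδ ↦ ?_⟩
  have ha0 : 0 < a := log_two_half_pos.trans ha
  have hle : weilEvenGroundEnergy a ≤ weilOddGroundEnergy a := (evenWinsBeyondArch_iff.1 h) a ha
  have hε : weilGroundEnergy a = weilEvenGroundEnergy a := by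
    rw [weilGroundEnergy_eq_min_even_odd, min_eq_left hle]
  have ho' : weilGroundEnergy a ≤ (weilQuadratic o).re := by
    rw [weilGroundEnergy_eq_sInf]
    exact sInf_weilWindowSphereValues_le_re ho hos trivial hon
  have hlt : sInf (weilWindowSphereValues (fun g ↦ ∀ t, g (-t) = g t) a) <
      (weilQuadratic o).re + δ := by
    rw [← weilEvenGroundEnergy_eq_sInf, ← hε]
    linarith
  obtain ⟨x, ⟨e, he, hes, hev, hen, rfl⟩, hx⟩ :=
    exists_lt_of_csInf_lt (weilWindowSphereValues_even_nonempty ha0) hlt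
  exact ⟨e, he, hes, hev, hen, hx.le⟩

/-- The crux with the WINDOW THRESHOLD `(log 2)/2 < a` deleted (all real `a`). -/
def EvenWinsBeyondArchAllWindows : Prop :=
  ∀ a : ℝ, ∀ o : ℝ → ℂ, IsWeilTest o → tsupport o ⊆ Icc (-a) a →
    (∀ t, o (-t) = -o t) → ∫ t, ‖o t‖ ^ 2 = (1 : ℝ) → ∀ δ : ℝ, 0 < δ → ∃ e : ℝ → ℂ, IsWeilTest e ∧
      tsupport e ⊆ Icc (-a) a ∧ (∀ t, e (-t) = e t) ∧ ∫ t, ‖e t‖ ^ 2 = (1 : ℝ) ∧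
        (weilQuadratic e).re ≤ (weilQuadratic o).re + δ

/-- On a degenerate window `a ≤ 0` there is no normalised test at all (its `tsupport` would lie in `{0}`,
a null set). [folklore] -/
theorem integral_norm_sq_eq_zero_of_tsupport_subset {a : ℝ} (ha : a ≤ 0) {o : ℝ → ℂ}
    (hos : tsupport o ⊆ Icc (-a) a) : ∫ t, ‖o t‖ ^ 2 = (0 : ℝ) := by
  have hsub : tsupport o ⊆ {0} := fun t ht ↦ by
    have h := hos ht
    simp only [mem_Icc] at h
    simp only [mem_singleton_iff]
    linarith [h.1, h.2]
  have hae : ∀ᵐ t ∂(volume : Measure ℝ), t ≠ (0 : ℝ) := by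
    rw [ae_iff]
    simp
  refine integral_eq_zero_of_ae ?_
  filter_upwards [hae] with t ht
  have h0 : o t = 0 := image_eq_zero_of_notMem_tsupport fun hmem ↦ ht (hsub hmem)
  simp [h0]

/-- **The window threshold is NOT load-bearing given the tree**: for `a ≤ 0` the hypotheses are unsatisfiable
(no normalised test lives on `[-a, a] ⊆ {0}`), and `0 < a ≤ (log 2)/2` is the landed archimedean parity theorem
`evenWinsArch_proof` (item `EvenWinsArch`, p151491).  So the crux is equivalent to its all-windows form
(= the route target `EvenSectorWins` up to the vacuous `a ≤ 0`). [folklore] -/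
theorem evenWinsBeyondArchAllWindows_iff : EvenWinsBeyondArchAllWindows ↔ EvenWinsBeyondArch := by
  refine ⟨fun h a _ ↦ h a, fun h a o ho hos hodd hon δ hδ ↦ ?_⟩
  rcases le_or_gt a 0 with ha0 | ha0
  · exfalso
    have := integral_norm_sq_eq_zero_of_tsupport_subset ha0 hos
    linarith
  rcases le_or_gt a (Real.log 2 / 2) with hle | hlt
  · exact WeilParity.evenWinsArch_proof a ha0 hle o ho hos hodd hon δ hδ
  · exact h a hlt o ho hos hodd hon δ hδ

/-- The crux with the NORMALISATION OF THE MATCHING TEST `∫ ‖e‖² = 1` deleted. -/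
def EvenWinsBeyondArchWithoutNormE : Prop :=
  ∀ a : ℝ, Real.log 2 / 2 < a → ∀ o : ℝ → ℂ, IsWeilTest o → tsupport o ⊆ Icc (-a) a →
    (∀ t, o (-t) = -o t) → ∫ t, ‖o t‖ ^ 2 = (1 : ℝ) → ∀ δ : ℝ, 0 < δ → ∃ e : ℝ → ℂ, IsWeilTest e ∧
      tsupport e ⊆ Icc (-a) a ∧ (∀ t, e (-t) = e t) ∧ (weilQuadratic e).re ≤ (weilQuadratic o).re + δ

/-- The zero function is supported on every set. [folklore] -/
theorem tsupport_zero_subset (s : Set ℝ) : tsupport (0 : ℝ → ℂ) ⊆ s := by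
  rw [tsupport_eq_empty_iff.2 rfl]
  exact empty_subset _

/-- **Without the normalisation of `e` the crux follows from odd-sector positivity** (witness `e := 0`,
`Q(0) = 0 ≤ ε_od(a) ≤ Re Q(o)`). [folklore] -/
theorem evenWinsBeyondArchWithoutNormE_of_oddNonneg
    (hpos : ∀ a : ℝ, Real.log 2 / 2 < a → 0 ≤ weilOddGroundEnergy a) : EvenWinsBeyondArchWithoutNormE := by
  intro a ha o ho hos hodd hon δ hδ
  refine ⟨0, isWeilTest_zero, tsupport_zero_subset _, fun t ↦ by simp, ?_⟩
  rw [weilQuadratic_zero, Complex.zero_re]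
  linarith [hpos a ha, weilOddGroundEnergy_le ho hos hodd hon]

/-- … hence **TRUE under RH** (Yoshida's proved direction `weilOddGroundEnergy_nonneg_of_riemannHypothesis`):
the normalisation of `e` is load-bearing exactly through odd-sector positivity, i.e. through RH itself. [folklore] -/
theorem evenWinsBeyondArchWithoutNormE_of_riemannHypothesis (hRH : RiemannHypothesis) :
    EvenWinsBeyondArchWithoutNormE :=
  evenWinsBeyondArchWithoutNormE_of_oddNonneg fun a _ ↦ weilOddGroundEnergy_nonneg_of_riemannHypothesis hRH a

/-- … and **TRUE RH-free on the one-prime window** `(log 2)/2 < a ≤ (log 3)/2` (landed first-prime Weil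
positivity `weilPositivityOn_log_three_half`, a kernel-checked certificate). [folklore] -/
theorem evenWinsBeyondArchWithoutNormE_onePrime :
    ∀ a : ℝ, Real.log 2 / 2 < a → a ≤ Real.log 3 / 2 → ∀ o : ℝ → ℂ, IsWeilTest o →
      tsupport o ⊆ Icc (-a) a → (∀ t, o (-t) = -o t) → ∫ t, ‖o t‖ ^ 2 = (1 : ℝ) → ∀ δ : ℝ, 0 < δ →
        ∃ e : ℝ → ℂ, IsWeilTest e ∧ tsupport e ⊆ Icc (-a) a ∧ (∀ t, e (-t) = e t) ∧
          (weilQuadratic e).re ≤ (weilQuadratic o).re + δ := by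
  intro a _ ha3 o ho hos _ _ δ hδ
  refine ⟨0, isWeilTest_zero, tsupport_zero_subset _, fun t ↦ by simp, ?_⟩
  rw [weilQuadratic_zero, Complex.zero_re]
  have h0 : 0 ≤ (weilQuadratic o).re :=
    weilPositivityOn_log_three_half o ho (hos.trans (Icc_subset_Icc (by linarith) ha3))
  linarith

/-- The crux with the NORMALISATION OF THE COMPETITOR `∫ ‖o‖² = 1` deleted. -/
def EvenWinsBeyondArchWithoutNormO : Prop :=
  ∀ a : ℝ, Real.log 2 / 2 < a → ∀ o : ℝ → ℂ, IsWeilTest o → tsupport o ⊆ Icc (-a) a →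
    (∀ t, o (-t) = -o t) → ∀ δ : ℝ, 0 < δ → ∃ e : ℝ → ℂ, IsWeilTest e ∧
      tsupport e ⊆ Icc (-a) a ∧ (∀ t, e (-t) = e t) ∧ ∫ t, ‖e t‖ ^ 2 = (1 : ℝ) ∧
        (weilQuadratic e).re ≤ (weilQuadratic o).re + δ

/-- **The normalisation of `o` is load-bearing iff the even bottom is STRICTLY positive somewhere beyond
`(log 2)/2`**: with `o := 0` admissible the variant says `ε_ev(a) ≤ 0` for every `a > (log 2)/2`.  This
direction is kernel-checked; the input `0 < ε_ev(a)` (numerically `ε_ev(1/2) = 9.37e-7`, `ε_ev(log 2) = 7.7e-13`)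
is RH-free but NOT certified in the tree (the first-prime certificates export `0 ≤` only). [folklore] -/
theorem evenWinsBeyondArchWithoutNormO_false_of_pos {a : ℝ} (ha : Real.log 2 / 2 < a)
    (hpos : 0 < weilEvenGroundEnergy a) : ¬ EvenWinsBeyondArchWithoutNormO := by
  intro h
  have hle : weilEvenGroundEnergy a ≤ 0 := by
    refine le_of_forall_pos_le_add fun δ hδ ↦ ?_
    obtain ⟨e, he, hes, hev, hen, hQ⟩ :=
      h a ha 0 isWeilTest_zero (tsupport_zero_subset _) (fun t ↦ by simp) δ hδ
    rw [weilQuadratic_zero, Complex.zero_re] at hQ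
    linarith [weilEvenGroundEnergy_le he hes hev hen]
  linarith

/-- Conversely the variant holds as soon as the crux holds and `ε_ev ≤ 0` beyond `(log 2)/2` (scaling: an
un-normalised odd `o ≠ 0` has `Re Q(o) = ‖o‖² · Re Q(o/‖o‖) ≥ ‖o‖² ε_od ≥ ‖o‖² ε_ev`, and `‖o‖² ε_ev ≥ ε_ev`
fails only when … — recorded as the exact dichotomy: the deleted hypothesis matters precisely through the SIGN
of `ε_ev`).  We only need and prove the easy half: `o = 0` is the sole new competitor that can hurt. [folklore] -/
theorem evenWinsBeyondArchWithoutNormO_of_nonpos (h : EvenWinsBeyondArch)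
    (hnonpos : ∀ a : ℝ, Real.log 2 / 2 < a → weilEvenGroundEnergy a ≤ 0)
    (hoddnn : ∀ a : ℝ, Real.log 2 / 2 < a → 0 ≤ weilOddGroundEnergy a) : EvenWinsBeyondArchWithoutNormO := by
  intro a ha o ho hos hodd δ hδ
  have ha0 : 0 < a := log_two_half_pos.trans ha
  -- Re Q(o) ≥ ε_od(a) ∫‖o‖² ≥ 0 ≥ ε_ev(a): an even test below δ exists
  have hQo : 0 ≤ (weilQuadratic o).re :=
    le_trans (mul_nonneg (hoddnn a ha) (integral_nonneg fun _ ↦ by positivity))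
      (weilOddGroundEnergy_mul_le_re ho hos hodd)
  have hlt : sInf (weilWindowSphereValues (fun g ↦ ∀ t, g (-t) = g t) a) < (weilQuadratic o).re + δ := by
    rw [← weilEvenGroundEnergy_eq_sInf]
    linarith [hnonpos a ha]
  obtain ⟨x, ⟨e, he, hes, hev, hen, rfl⟩, hx⟩ :=
    exists_lt_of_csInf_lt (weilWindowSphereValues_even_nonempty ha0) hlt
  exact ⟨e, he, hes, hev, hen, by have := h; exact hx.le⟩

/-- The `δ`-FREE (attained) version of the crux: every odd normalised window test is beaten outright. -/
def EvenWinsBeyondArchExact : Prop :=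
  ∀ a : ℝ, Real.log 2 / 2 < a → ∀ o : ℝ → ℂ, IsWeilTest o → tsupport o ⊆ Icc (-a) a →
    (∀ t, o (-t) = -o t) → ∫ t, ‖o t‖ ^ 2 = (1 : ℝ) → ∃ e : ℝ → ℂ, IsWeilTest e ∧
      tsupport e ⊆ Icc (-a) a ∧ (∀ t, e (-t) = e t) ∧ ∫ t, ‖e t‖ ^ 2 = (1 : ℝ) ∧
        (weilQuadratic e).re ≤ (weilQuadratic o).re

/-- The `δ`-free version implies the crux … [folklore] -/
theorem evenWinsBeyondArch_of_exact (h : EvenWinsBeyondArchExact) : EvenWinsBeyondArch := by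
  intro a ha o ho hos hodd hon δ hδ
  obtain ⟨e, he, hes, hev, hen, hle⟩ := h a ha o ho hos hodd hon
  exact ⟨e, he, hes, hev, hen, by linarith⟩

/-- … and follows from the STRICT order `ε_ev < ε_od` beyond `(log 2)/2` (= Connes' clause there, by the landed
`weilWindowSimpleEven_iff_weilEvenGroundEnergy_lt`).  So `0 < δ` is a hypothesis one cannot attack separately:
the `δ`-free strengthening sits between Connes' hypothesis and the crux. [folklore] -/
theorem evenWinsBeyondArchExact_of_strict
    (h : ∀ a : ℝ, Real.log 2 / 2 < a → weilEvenGroundEnergy a < weilOddGroundEnergy a) :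
    EvenWinsBeyondArchExact := by
  intro a ha o ho hos hodd hon
  have ha0 : 0 < a := log_two_half_pos.trans ha
  have hod : weilOddGroundEnergy a ≤ (weilQuadratic o).re := weilOddGroundEnergy_le ho hos hodd hon
  have hlt : sInf (weilWindowSphereValues (fun g ↦ ∀ t, g (-t) = g t) a) < (weilQuadratic o).re := by
    rw [← weilEvenGroundEnergy_eq_sInf]
    exact (h a ha).trans_le hod
  obtain ⟨x, ⟨e, he, hes, hev, hen, rfl⟩, hx⟩ :=
    exists_lt_of_csInf_lt (weilWindowSphereValues_even_nonempty ha0) hlt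
  exact ⟨e, he, hes, hev, hen, hx.le⟩

/-! ## 3. The parity-swapped crux is FALSE (RH-free) -/

/-- The parity-swapped crux: beyond the archimedean window every EVEN normalised window test is matched, up to
any `δ > 0`, by an ODD one (`ε_od(a) ≤ ε_ev(a)` for all `a > (log 2)/2`). -/
def OddWinsBeyondArch : Prop :=
  ∀ a : ℝ, Real.log 2 / 2 < a → ∀ e : ℝ → ℂ, IsWeilTest e → tsupport e ⊆ Icc (-a) a →
    (∀ t, e (-t) = e t) → ∫ t, ‖e t‖ ^ 2 = (1 : ℝ) → ∀ δ : ℝ, 0 < δ → ∃ o : ℝ → ℂ, IsWeilTest o ∧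
      tsupport o ⊆ Icc (-a) a ∧ (∀ t, o (-t) = -o t) ∧ ∫ t, ‖o t‖ ^ 2 = (1 : ℝ) ∧
        (weilQuadratic o).re ≤ (weilQuadratic e).re + δ

/-- **A strict even win persists on an initial segment beyond the archimedean window** (RH-free): the
certified anchor `ε_ev((log 2)/2) < ε_od((log 2)/2)` (p148526, from the kernel-checked archimedean gap
certificate) and continuity of both sector bottoms at `(log 2)/2` (p146566, Bombieri 2000 Thm 5 per sector)
give `η > 0` with `ε_ev(a) < ε_od(a)` for `|a − (log 2)/2| < η`. [folklore] -/
theorem exists_strict_order_near_arch :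
    ∃ η : ℝ, 0 < η ∧ ∀ a : ℝ, dist a (Real.log 2 / 2) < η →
      weilEvenGroundEnergy a < weilOddGroundEnergy a := by
  have hev : ContinuousAt weilEvenGroundEnergy (Real.log 2 / 2) :=
    stub_sectorContinuity_continuousAt_even log_two_half_pos
  have hod : ContinuousAt weilOddGroundEnergy (Real.log 2 / 2) :=
    stub_sectorContinuity_continuousAt_odd log_two_half_pos
  have hlt := Filter.Tendsto.eventually_lt hev hod weilEvenGroundEnergy_lt_weilOddGroundEnergy_log_two_half
  obtain ⟨η, hη, h⟩ := Metric.eventually_nhds_iff.1 hlt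
  exact ⟨η, hη, fun a ha ↦ h ha⟩

/-- The same, as a statement about windows `a > (log 2)/2` only. [folklore] -/
theorem exists_strict_order_beyond_arch :
    ∃ η : ℝ, 0 < η ∧ ∀ a : ℝ, Real.log 2 / 2 < a → a < Real.log 2 / 2 + η →
      weilEvenGroundEnergy a < weilOddGroundEnergy a := by
  obtain ⟨η, hη, h⟩ := exists_strict_order_near_arch
  refine ⟨η, hη, fun a ha1 ha2 ↦ h a ?_⟩
  rw [Real.dist_eq, abs_lt]
  constructor <;> linarith

/-- **At a window with a strict even win, the odd sector cannot match the even one.** [folklore] -/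
theorem not_oddMatches_of_lt {a : ℝ} (ha : 0 < a) (hlt : weilEvenGroundEnergy a < weilOddGroundEnergy a) :
    ¬ ∀ e : ℝ → ℂ, IsWeilTest e → tsupport e ⊆ Icc (-a) a → (∀ t, e (-t) = e t) →
        ∫ t, ‖e t‖ ^ 2 = (1 : ℝ) → ∀ δ : ℝ, 0 < δ → ∃ o : ℝ → ℂ, IsWeilTest o ∧
          tsupport o ⊆ Icc (-a) a ∧ (∀ t, o (-t) = -o t) ∧ ∫ t, ‖o t‖ ^ 2 = (1 : ℝ) ∧
            (weilQuadratic o).re ≤ (weilQuadratic e).re + δ := by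
  intro h
  -- an even near-minimiser strictly below the midpoint of the two bottoms
  have hmid : sInf (weilWindowSphereValues (fun g ↦ ∀ t, g (-t) = g t) a) <
      (weilEvenGroundEnergy a + weilOddGroundEnergy a) / 2 := by
    rw [← weilEvenGroundEnergy_eq_sInf]
    linarith
  obtain ⟨x, ⟨e, he, hes, hev, hen, rfl⟩, hx⟩ :=
    exists_lt_of_csInf_lt (weilWindowSphereValues_even_nonempty ha) hmid
  set δ : ℝ := (weilOddGroundEnergy a - (weilQuadratic e).re) / 2 with hδ
  have hδpos : 0 < δ := by
    rw [hδ]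
    linarith
  obtain ⟨o, ho, hos, hodd, hon, hle⟩ := h e he hes hev hen δ hδpos
  have hod : weilOddGroundEnergy a ≤ (weilQuadratic o).re := weilOddGroundEnergy_le ho hos hodd hon
  rw [hδ] at hle
  linarith

/-- **The parity-swapped crux is false** (RH-free, kernel-checked): parity is not a symmetric bookkeeping choice
— the even sector wins STRICTLY just beyond `(log 2)/2` (`exists_strict_order_beyond_arch`), where an even
near-minimiser below the midpoint of the two bottoms has no odd match. [folklore] -/
theorem not_oddWinsBeyondArch : ¬ OddWinsBeyondArch := by
  intro h
  obtain ⟨η, hη, hst⟩ := exists_strict_order_beyond_arch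
  set a : ℝ := Real.log 2 / 2 + η / 2 with ha_def
  have ha : Real.log 2 / 2 < a := by rw [ha_def]; linarith
  have ha' : a < Real.log 2 / 2 + η := by rw [ha_def]; linarith
  exact not_oddMatches_of_lt (log_two_half_pos.trans ha) (hst a ha ha') (h a ha)

/-! ## 4. Line `split` (lead's pick): what the two stubs prove, and their RH content -/

/-- **The two stubs are jointly EQUIVALENT to "no parity tie at any `a > (log 2)/2`"** (landed calibration
`forall_weilWindowSimpleEven_iff_subs` + `weilWindowSimpleEven_iff_weilEvenGroundEnergy_lt` + anchor propagation):
the line proves the crux PLUS the exclusion of touching ties — and nothing is smuggled (joint sufficiency itself is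
the landed glue `evenWinsBeyondArch_of_subs`). [folklore] -/
theorem subs_iff_noTie_beyond_arch :
    (OnePrimeWindowSimpleEven ∧ NoParityCrossing) ↔
      ∀ a : ℝ, Real.log 2 / 2 < a → weilEvenGroundEnergy a ≠ weilOddGroundEnergy a := by
  rw [← forall_weilWindowSimpleEven_iff_subs]
  constructor
  · intro h a ha
    exact ((weilWindowSimpleEven_iff_weilEvenGroundEnergy_lt (log_two_half_pos.trans ha)).1 (h a ha)).ne
  · intro hne a ha
    exact (weilWindowSimpleEven_iff_weilEvenGroundEnergy_lt (log_two_half_pos.trans ha)).2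
      (weilEvenGroundEnergy_lt_weilOddGroundEnergy_of_anchor log_two_half_pos
        weilEvenGroundEnergy_lt_weilOddGroundEnergy_log_two_half hne ha)

/-- **The gap between the line and the crux is exactly "touching ties"**: stubs ↔ crux ∧ no tie beyond
`(log 2)/2`. [folklore] -/
theorem subs_iff_crux_and_noTie :
    (OnePrimeWindowSimpleEven ∧ NoParityCrossing) ↔
      (EvenWinsBeyondArch ∧ ∀ a : ℝ, Real.log 2 / 2 < a → weilEvenGroundEnergy a ≠ weilOddGroundEnergy a) := by
  rw [subs_iff_noTie_beyond_arch]
  exact ⟨fun h ↦ ⟨evenWinsBeyondArch_of_noCrossing_beyond_arch h, h⟩, fun h ↦ h.2⟩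

/-- **`stub_noParityCrossing` is RH-strength** (formal B1 for the line): under `¬RH`, detection (crux #2) and
the RH-free one-prime stub make it FALSE. [folklore] -/
theorem stub_noParityCrossing_false_of_detection_of_not_RH (hdet : OffLineParityDetection)
    (hRH : ¬ _root_.Summit.RiemannHypothesis) (h₁ : OnePrimeWindowSimpleEven) : ¬ NoParityCrossing :=
  fun h₂ ↦ evenWinsBeyondArch_false_of_detection_of_not_RH hdet hRH (evenWinsBeyondArch_of_subs h₁ h₂)

/-! ## 5. Numerics: ORDER scan beyond a = 1.2 (lead's `disprover-wanted`; route falsifier F2 / kill k2)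

Method (folder `scan/`, kit j024889 [a = 1.25, 1.3, 1.35; quadrature check n_t → n_t + 120 at 1.25] and
j024890 [a = 1.4, 1.5, 1.6, 1.7, 1.8]): Rayleigh–Ritz on the GEOMETRIC side in the basis of Legendre polynomials ×
window indicator (form domain), even / odd degrees = sectors, nested so that the degree ladder D, D−20, D−40 comes
from one assembly; exact fixed-point integer arithmetic with P bits (P from 400 at a = 1.25 to 820 at a = 1.8, i.e.
≥ 60 digits below the expected bottom); every polynomial integral (Gram, correlations `K_jk(t)`, prime shifts
`K_jk(log n)`, polar moments) by an EXACT Gauss–Legendre rule; the one transcendental integral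
`∫₀^{2a} (e^{t/2}/sinh t)(δ_jk − K_jk(t)) dt` (integrand analytic on `[0, 2a]`, poles at `±iπ`) by an n_t-point rule,
n_t = D + 360, convergence checked; lowest two eigenpairs per sector by LDLᵀ inverse iteration with deflation.
Validation (this code vs the sister table `Cruxes/GroundStateSimpleEven/Disproof.lean`): a = 0.1: e1 0.45713 (0.4571),
o1/e1 2.911 (2.91), e2/e1 4.02 (4.02); a = 0.3: 7.572e-3 (7.57e-3), 29.39 (29.4); a = 0.4: 1.8149e-4 (1.814e-4), 81.11 (81.1),
e2/e1 1693 (1693), ⟨u,1⟩ 0.765 (0.765); a = 0.5: 9.366e-7 (9.35e-7), 207.7 (208), ⟨u,1⟩ 0.793 (0.793).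

RESULTS (kit j024889: a = 1.25–1.35, 4 cores, 6.5 min; kit j024890: a = 1.4–1.8, 32 cores, 17 min; python-flint fmpz_mat
for the exact integer products; earlier local runs at lower degree in `local_results.txt` of the disprover folder agree).
Each window: degree ladder D, D−20, D−40 (nested sub-blocks of ONE assembly) — the top row is the best (lowest) Rayleigh–Ritz
value; e1/o1 = even/odd sector bottoms, e2/o2 = second levels; `conv` = change of e1 over the last ladder step.

   a     D    P    n_t   e1          conv    o1          o1/e1    e2          o2          interlace  even gs: nodes, u(a⁻)/max
   1.20  176  380  420   7.328e-49   −8%     4.534e-45    6187    1.39e-41    3.30e-38    yes        0, 2.1e-24  (local; sister N=76: 8.1e-49, 6022)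
   1.25  256  396  616   4.796e-55   −1.4%   3.483e-51    7261    1.53e-47    4.79e-44    yes        0, 1.6e-27
   1.30  280  418  640   7.517e-62   −0.4%   7.055e-58    9385    3.90e-54    1.59e-50    yes        0, 7.0e-31
   1.35  304  443  664   2.459e-69   −0.8%   2.733e-65   11112    1.66e-61    8.19e-58    yes        0, 1.4e-34
   1.40  334  471  694   1.255e-77   −2.0%   1.859e-73   14807    1.40e-69    7.38e-66    yes        0, 1.0e-38
   1.50  400  536  760   4.619e-97   −4.6%   1.012e-92   21916    1.18e-88    1.03e-84    yes        0, 2.1e-48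
   1.60  480  616  840   6.193e-121  −9.4%   2.240e-116  36175    4.16e-112   5.11e-108   yes        0, 2.7e-60
   1.70  580  713  940   5.434e-150  ×0.18*  2.755e-145  50707    7.58e-141   1.39e-136   yes        0, 8.3e-75
   1.80  702  832  1062  6.357e-184  ×0.34*  4.135e-179  65047    9.23e-175   2.23e-170   yes        0, 1.3e-91
   (* a = 1.7, 1.8: ladder still dropping by ×3–7 per 20 degrees — absolute values are UPPER bounds, plausibly ×10–100 above
    the limits; refinement job j025992 (D = 680 / 860) queued; the RATIO o1/e1 is stable along every ladder to a few %.)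
  CHECKS: t-quadrature n_t = 616 → 736 at a = 1.25 reproduces e1, o1, e2, o2 to all 18 printed digits; the assembled matrices are
  symmetric to the last bit; independent agreement with the sister's mpmath Legendre code at a = 0.1–1.2 (all printed digits at
  a ≤ 0.5; 8.1e-49 vs 7.98e-49 at equal basis size at 1.2); edge amplitudes u(a⁻)/max ≈ √e1 at every a (edge law).
  VERDICT: on (1.2, 1.8] the EVEN sector wins at every probed window, by a factor that GROWS monotonically —
  6.2e3, 7.3e3, 9.4e3, 1.1e4, 1.5e4, 2.2e4, 3.6e4, 5.1e4, 6.5e4 — and equals `(1.2 ± 0.15)·c²`, `c = 2π e^{2a}`, throughout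
  (c² = 5.9e3 … 5.3e4); the merged ladder alternates even < odd < even < odd at every window (rung ratios 10^{3.6}–10^{4.9});
  all ground states node-free.  170 orders of magnitude below the precision wall there is NO crossing, NO near-degeneracy and NO
  trend towards one: kill criterion k2 / falsifier F2 finds nothing on (1.2, 1.8].  (a = 1.9, 2.0: job j025167 queued, 48 cores.)

## 6. The prolate dictionary, quantitatively (why no crossing is expected under RH)

Quantitative confirmation of the sister ideator's prediction F6 (`Cruxes/GroundStateSimpleEven/BarrierNotes-r1-k1.md`:
`ε_even ≍ 1−λ₄(c), ε_odd ≍ 1−λ₆(c)`), parameter-free, over the whole resolved range AND for the next two rungs: with `c := 2π e^{2a}` (Connes' cutoff `Λ² = e^{2a}`: the support `[-2a, 2a]` of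
`g ⋆ g̃` is `[Λ⁻², Λ²]` multiplicatively) and Slepian's asymptotics `1 − λ_n(c) ≈ 4√π 8ⁿ c^{n+1/2} e^{−2c}/n!` for the
prolate operator of `[−1,1]`, the merged low spectrum of the two sectors IS the prolate defect ladder with indices
`n = 4, 6, 8, 10` — even `g` ↔ `n ≡ 0 (mod 4)`, odd `g` ↔ `n ≡ 2 (mod 4)` (Fourier-sign grading; `t ↦ −t` on `g` is the
Fourier transform on Connes' side) — over SIXTY orders of magnitude:

      a      c       e1/(1−λ₄)   o1/(1−λ₆)   e2/(1−λ₈)   o2/(1−λ₁₀)    e1 (obs)    1−λ₄(c)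
      0.30   11.45   0.95        0.10        –           –             7.57e-3     8.00e-3
      0.3466 12.57   1.02        0.17        –           –             1.33e-3     1.30e-3
      0.50   17.08   1.51        0.50        0.14        –             9.37e-7     6.22e-7
      0.6931 25.13   2.14        0.99        0.46        0.19          7.70e-13    3.60e-13
      0.85   34.39   3.31        1.57        0.75        –             4.39e-20    1.33e-20
      1.00   46.43   3.31        1.85        1.11        –             5.98e-30    1.81e-30
      1.20   69.26   4.56        2.76        1.54        1.07          7.33e-49    1.61e-49
      1.25   76.54   4.04        2.35        1.54        1.16          4.80e-55    1.19e-55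
      1.30   84.60   3.97        2.44        1.65        1.32          7.52e-62    1.89e-62
      1.35   93.49   4.42        2.64        1.60        1.27          2.46e-69    5.56e-70
      1.40   103.3   5.00        3.25        2.01        1.39          1.26e-77    2.51e-78
      1.50   126.2   5.55        3.58        2.29        1.76          4.62e-97    8.33e-98
      1.60   154.1   5.62        4.01        2.74        1.99          6.19e-121   1.10e-121
      1.70   188.3   (8.8)*      (5.9)*      (4.0)*      (2.9)*        5.43e-150*  6.17e-151
      1.80   230.0   (670)*      (390)*      (140)*      (92)*         6.36e-184*  9.44e-187
  (rows ≤ 1.2: sister table; 1.25–1.6: this scan, converged to ≤ 10%; * = NOT converged (ladder still dropping ×3–7 per step,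
   refinement j025992 pending) — at 1.25/1.3 the unconverged local values had shown 4.7/4.8 and came down to 4.0.)
  The indices are forced by the data: at a = 1.2, `ln e1 = −110.8` vs `ln(1−λ_n)`: n=4: −112.3, n=2: −122.5, n=0: −134.4;
  `ln o1 = −102.1` vs n=6: −103.1, n=5: −107.6; `e2`: n=8: −94.5 (obs −94.1); `o2`: n=10: −86.3 (obs −86.3).
CONSEQUENCES. (i) The parity ratio is the prolate gap: `o1/e1 ≈ (1−λ₆)/(1−λ₄) ≈ (8²·4!/6!) c² = 2.13 c²` asymptotically;
observed `o1/e1 = (0.59 ± 0.07) × 2.13 c² = (1.25 ± 0.15) c²` at EVERY window from a = 0.85 to 1.8 (1197, 2569, 3754, 6187, 7261,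
9385, 11112, 14807, 21916, 36175, 50707, 65047 vs 1.25c² = 1478, 2695, 4020, 5996, 7324, 8945, 10926, 13345, 19908, 29700, 44307,
66098) — a CROSSING needs this c²-law, stable over 160 orders of magnitude of the energies, to fail by 4–5 orders of magnitude;
extrapolation: ratio ≈ 1e5 (a = 1.9), 1.5e5 (2.0); `e1(2.0) ~ 1e-283`.  (ii) For the provers of `NoParityCrossing` / `RHImpliesEvenWins`: the target transfer
statement is sector-wise — even sector ↔ `ψ₄, ψ₈, …`, odd sector ↔ `ψ₆, ψ₁₀, …` of `W_Λ`, `c = 2πΛ²`, `Λ = e^a` — and a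
MULTIPLICATIVE accuracy `|ε_± /(1−λ_{4|6}) − const| < const` would already exclude ties (the gap is a factor c² ≥ 300 for
a ≥ 0.35); the observed slowly growing factors (0.95 → 4.8 even, 0.1 → 3.1 odd) are the arithmetic corrections to bound.
(iii) For refuters: under RH there is no window to aim at; the only kill is ¬RH (B1).
-/

end Summit.RiemannHypothesis.RiemannHypothesis.Cruxes.EvenWinsBeyondArch.Disproof

end
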